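import Mathlib

/-!
# J-frame symbol bookkeeping — `(E×E, J)`, the curve-independent split of NS and the dictionary to the record frame
(plan-lens-HodgeAV-embed g5; BOOKKEEPING ONLY)

HONEST FRAMING. Companion of `Cruxes/BlochSeedDiscOne/CURVE-INDEPENDENCE-embed-g5.md` §2–§4. Nothing here is proved toward
HC ∕ HC_CM ∕ HC_AV ∕ № 4 ∕ 26512 ∕ 18881 ∕ H2; no abelian variety, line bundle, cohomology class, sheaf or seed is constructed, and the
identification `NS(E×E) ≅ {Hermitian [[a₁, α],[ᾱ, a₂]] : aᵢ ∈ ℤ, α ∈ End E}` with pull-back `H ↦ Mᵀ H M̄` (Birkenhake–Lange, Prop. 2.4.12)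
is NOT formalised — it is the dictionary under which the statements below are read. What is kernel-checked is the finite symbol algebra
the memo uses: over an arbitrary commutative star-ring `R` (standing for `End E ⊗ ℚ(i)` resp. a ring containing `End E`), for the
matrix `J = [[0,1],[−1,0]]`:
* `pull_Jm` — `J^*[[a₁, α],[ᾱ, a₂]] = [[a₂, −ᾱ],[−α, a₁]]`, hence the sufficient conditions for `Inv` (`a₁ = a₂`, `ᾱ = −α`) and
  `Anti` (`a₂ = −a₁`, `ᾱ = α`), memo THEOREM CI (i);
* `det_herm`, `det_letter` — `V(a·I + d·σ_θ + g·L_g + b·L_b) = a² − D·d² − g² − b²` whenever `θ² = −D`, `θ̄ = −θ` (memo §2 (ii), any CM);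
* `pull_unit_scalar` — unit scalars (`u·ū = 1`, e.g. `μ₆ ⊂ Aut E_ω`) act trivially on symbols (memo §2 (iv));
* `pull_one_add_Jm`, `pull_one_add_Jm_letter` — the quarter-turn `(1+J)^*(aI + dσ + gL_g + bL_b) = 2(aI + dσ − bL_g + gL_b)`;
* `Pm_intertwines`, `det_Pm`, `pull_Pm` — the isogeny `Π = [[1,1],[i,−i]]` with `Π ∘ diag(i,−i) = J ∘ Π`, `det Π = −2i`, and the closed
  form `Π^*[[a₁, r+si],[r−si, a₂]] = [[a₁+a₂+2s, (a₁−a₂)+2ri],[…, a₁+a₂−2s]]` (memo §3), for any `i` with `i² = −1`, `ī = −i`;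
* `pull_rotm` — on the record frame the automorphism `diag(1,i)` rotates the Weil coordinate, `β ↦ −iβ`;
* `det_unit_curve`, `det_omega_curve` — unit curves `[[1, u],[ū, 1]]` are null (`u·ū = 1`), in particular for a primitive cube root
  `ω` (`ω² + ω + 1 = 0`, `ω̄ = −1 − ω`);
* `pellm_comm`, `det_pellm`, `pull_pellm_I`, `det_pull_pellm_I`, `pull_pellm_tau`, `pull_pellm_Lg`, `pull_pellm_Lb` — the UNPOLARIZED
  automorphism `1 + ωJ` of `(E_ω², J)` (det `−ω`): `I ↦ 2I − τ` (principal again), `τ ↦ −3I + 2τ` (Pell unit `2 + √3` on the `μ`-blind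
  plane `a² − 3d²`), `L_g ↦ −L_b`, `L_b ↦ L_g` (quarter-turn on the charged letters) — memo §4 (P).
No `sorry`, no new axioms, no instances, no notation, no unsafe options.
-/

namespace Summit.HodgeConjecture.HodgeConjecture.Cruxes.BlochSeedDiscOne.JFrame

-- the namespace mirrors the tree path `Summits/HodgeConjecture/HodgeConjecture/Cruxes/…` (as in the sibling files)
set_option linter.dupNamespace false

open Matrix

variable {R : Type*} [CommRing R] [StarRing R]

/-- Hermitian symbol `[[a₁, α],[ᾱ, a₂]]` with integer diagonal (a class in `NS(E×E)` under the dictionary of the memo). -/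
def herm (a₁ a₂ : ℤ) (α : R) : Matrix (Fin 2) (Fin 2) R :=
  !![(a₁ : R), α; star α, (a₂ : R)]

/-- The matrix of `J(z₁,z₂) = (z₂, −z₁)`. -/
def Jm : Matrix (Fin 2) (Fin 2) R := !![0, 1; -1, 0]

/-- Pull-back of a symbol by the endomorphism with matrix `M`: `Mᵀ · H · M̄` (convention `H(z,w) = zᵀ H w̄`). -/
def pull (M H : Matrix (Fin 2) (Fin 2) R) : Matrix (Fin 2) (Fin 2) R :=
  Mᵀ * H * M.map star

/-- The isogeny `Π = [[1,1],[i,−i]]` from the record frame `(E_i², diag(i,−i))` to the J-frame `(E_i², J)`. -/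
def Pm (i : R) : Matrix (Fin 2) (Fin 2) R := !![1, 1; i, -i]

/-- The record frame's complex multiplication `diag(i, −i)`. -/
def phim (i : R) : Matrix (Fin 2) (Fin 2) R := !![i, 0; 0, -i]

/-- The record frame's automorphism `diag(1, i)` (a quarter-turn of the Weil phase). -/
def rotm (i : R) : Matrix (Fin 2) (Fin 2) R := !![1, 0; 0, i]

omit [StarRing R] in
theorem Jm_sq : (Jm : Matrix (Fin 2) (Fin 2) R) * Jm = -1 := by
  ext x y; fin_cases x <;> fin_cases y <;> simp [Jm, Matrix.mul_apply, Fin.sum_univ_two]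

omit [StarRing R] in
theorem det_one_add_Jm : ((1 : Matrix (Fin 2) (Fin 2) R) + Jm).det = 2 := by
  simp [Jm, Matrix.det_fin_two]; norm_num

/-- THEOREM CI (i): `J^*[[a₁, α],[ᾱ, a₂]] = [[a₂, −ᾱ],[−α, a₁]]`. -/
theorem pull_Jm (a₁ a₂ : ℤ) (α : R) : pull Jm (herm a₁ a₂ α) = herm a₂ a₁ (-(star α)) := by
  ext x y; fin_cases x <;> fin_cases y <;> simp [pull, Jm, herm, Matrix.mul_apply, Fin.sum_univ_two]

/-- `Inv`: symbols with `a₁ = a₂` and `ᾱ = −α` (e.g. `I = herm 1 1 0`, `σ_θ = herm 0 0 θ` with `θ̄ = −θ`) are `J`-invariant. -/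
theorem pull_Jm_of_inv (a : ℤ) (α : R) (hα : star α = -α) : pull Jm (herm a a α) = herm a a α := by
  rw [pull_Jm, hα, neg_neg]

/-- `Anti`: symbols with `a₂ = −a₁` and `ᾱ = α` (i.e. `g·L_g + b·L_b = herm g (−g) b`, `b` self-adjoint — for an elliptic curve `b ∈ ℤ`)
are `J`-anti-invariant. -/
theorem pull_Jm_of_anti (a : ℤ) (α : R) (hα : star α = α) : pull Jm (herm a (-a) α) = -(herm a (-a) α) := by
  rw [pull_Jm, hα]
  ext x y; fin_cases x <;> fin_cases y <;> simp [herm, hα]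

/-- The charged letters `g·L_g + b·L_b` with `g b : ℤ` are anti-invariant over ANY star-ring (curve independence of `Anti`). -/
theorem pull_Jm_intLetter (g b : ℤ) : pull Jm (herm g (-g) (b : R)) = -(herm g (-g) (b : R)) :=
  pull_Jm_of_anti g (b : R) (star_intCast b)

/-- `V = det`: `det [[a₁, α],[ᾱ, a₂]] = a₁a₂ − αᾱ`. -/
theorem det_herm (a₁ a₂ : ℤ) (α : R) : (herm a₁ a₂ α).det = (a₁ : R) * a₂ - α * star α := by
  simp [herm, Matrix.det_fin_two]

/-- THEOREM CI (ii): for a CM (or no-CM, `d = 0`) letter `a·I + d·σ_θ + g·L_g + b·L_b = [[a+g, b+dθ],[b−dθ, a−g]]` with `θ² = −D`,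
`θ̄ = −θ`: `V = a² − D d² − g² − b²`. -/
theorem det_letter (a g b d D : ℤ) (θ : R) (hθ : θ * θ = -(D : R)) (hs : star θ = -θ) :
    (herm (a + g) (a - g) ((b : R) + (d : R) * θ)).det = ((a ^ 2 - D * d ^ 2 - g ^ 2 - b ^ 2 : ℤ) : R) := by
  rw [det_herm]
  simp only [star_add, star_mul', star_intCast, hs]
  push_cast
  linear_combination ((d : R) ^ 2) * hθ

/-- Scalars pull back by `u·ū`. -/
theorem pull_smul_one (u : R) (H : Matrix (Fin 2) (Fin 2) R) :
    pull (u • (1 : Matrix (Fin 2) (Fin 2) R)) H = (u * star u) • H := by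
  ext x y; fin_cases x <;> fin_cases y <;> simp [pull, Matrix.mul_apply, Fin.sum_univ_two] <;> ring

/-- THEOREM CI (iv): unit scalars (`u·ū = 1`; e.g. `μ₄ ⊂ Aut E_i`, `μ₆ ⊂ Aut E_ω`) act trivially on symbols. -/
theorem pull_unit_scalar (u : R) (hu : u * star u = 1) (H : Matrix (Fin 2) (Fin 2) R) :
    pull (u • (1 : Matrix (Fin 2) (Fin 2) R)) H = H := by
  rw [pull_smul_one, hu, one_smul]

/-- The quarter-turn isogeny `1 + J` on symbols. -/
theorem pull_one_add_Jm (a₁ a₂ : ℤ) (α : R) :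
    pull (1 + Jm) (herm a₁ a₂ α) =
      !![(a₁ : R) + a₂ - (α + star α), (a₁ : R) - a₂ + (α - star α);
         (a₁ : R) - a₂ - (α - star α), (a₁ : R) + a₂ + (α + star α)] := by
  ext x y; fin_cases x <;> fin_cases y <;>
    simp [pull, Jm, herm, Matrix.mul_apply, Fin.sum_univ_two, Matrix.add_apply, Matrix.one_apply] <;> ring

/-- `(1+J)^*(a·I + d·σ_θ + g·L_g + b·L_b) = 2·(a·I + d·σ_θ − b·L_g + g·L_b)` (memo §2 (iv)): a quarter-turn of the Weil coordinate,
available on J-frames only through the degree-4 isogeny `1 + J`. -/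
theorem pull_one_add_Jm_letter (a g b d : ℤ) (θ : R) (hs : star θ = -θ) :
    pull (1 + Jm) (herm (a + g) (a - g) ((b : R) + (d : R) * θ))
      = (2 : R) • herm (a - b) (a + b) ((g : R) + (d : R) * θ) := by
  rw [pull_one_add_Jm]
  ext x y; fin_cases x <;> fin_cases y <;>
    simp [herm, hs, star_add, star_mul', star_intCast, Matrix.smul_apply] <;> ring

omit [StarRing R] in
/-- `Π ∘ diag(i,−i) = J ∘ Π` for `i² = −1` (memo §3): `Π` is `ℚ(i)`-linear from the record frame to the J-frame. -/
theorem Pm_intertwines (i : R) (hi : i * i = -1) : Pm i * phim i = Jm * Pm i := by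
  ext x y; fin_cases x <;> fin_cases y <;> simp [Pm, phim, Jm, Matrix.mul_apply, Fin.sum_univ_two] <;>
    linear_combination hi

omit [StarRing R] in
/-- `det Π = −2i`, so `deg Π = |det Π|² = 4`. -/
theorem det_Pm (i : R) : (Pm i).det = -2 * i := by
  simp [Pm, Matrix.det_fin_two]; ring

/-- The closed form of `Π^*` (memo §3): `Π^*[[a₁, r+si],[r−si, a₂]] = [[a₁+a₂+2s, (a₁−a₂)+2ri],[(a₁−a₂)−2ri, a₁+a₂−2s]]`, i.e.
`ι = Π^*/2` sends the J-symbol `(a; g, b; d)` to the record symbol `(a; d; β = g + ib)`. -/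
theorem pull_Pm (i : R) (hi : i * i = -1) (hs : star i = -i) (a₁ a₂ r s : ℤ) :
    pull (Pm i) (herm a₁ a₂ ((r : R) + (s : R) * i))
      = herm (a₁ + a₂ + 2 * s) (a₁ + a₂ - 2 * s) (((a₁ - a₂ : ℤ) : R) + ((2 * r : ℤ) : R) * i) := by
  ext x y; fin_cases x <;> fin_cases y
  · simp [pull, Pm, herm, Matrix.mul_apply, Fin.sum_univ_two, hs, star_add, star_mul', star_intCast]
    linear_combination (-((a₂ : R) + 2 * s)) * hi
  · simp [pull, Pm, herm, Matrix.mul_apply, Fin.sum_univ_two, hs, star_add, star_mul', star_intCast]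
    linear_combination ((a₂ : R)) * hi
  · simp [pull, Pm, herm, Matrix.mul_apply, Fin.sum_univ_two, hs, star_add, star_mul', star_intCast]
    linear_combination ((a₂ : R)) * hi
  · simp [pull, Pm, herm, Matrix.mul_apply, Fin.sum_univ_two, hs, star_add, star_mul', star_intCast]
    linear_combination (2 * (s : R) - a₂) * hi

/-- On the record frame the automorphism `diag(1,i)` rotates the Weil coordinate: `β ↦ −iβ` (memo §2 (iv)). -/
theorem pull_rotm (i : R) (hi : i * i = -1) (hs : star i = -i) (a₁ a₂ : ℤ) (β : R) :
    pull (rotm i) (herm a₁ a₂ β) = herm a₁ a₂ (-(i * β)) := by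
  ext x y; fin_cases x <;> fin_cases y <;>
    simp [pull, rotm, herm, Matrix.mul_apply, Fin.sum_univ_two, hs, star_mul', star_neg] <;>
    first
    | linear_combination (-(a₂ : R)) * hi
    | ring1

/-- Unit curves `Γ_{−u} = [[1, u],[ū, 1]]` (`u ū = 1`) are null. -/
theorem det_unit_curve (u : R) (hu : u * star u = 1) : (herm 1 1 u).det = 0 := by
  rw [det_herm]; push_cast; linear_combination (-1 : R) * hu

/-- The sextic unit curves of `E_ω × E_ω`: for `ω² + ω + 1 = 0`, `ω̄ = −1 − ω`, the symbol `[[1, ω],[ω̄, 1]]` is null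
(memo §4: the half-charged letters `(1; ±½; ±i/2)`, null only because `D = 3`). -/
theorem det_omega_curve (ω : R) (hω : ω * ω + ω + 1 = 0) (hs : star ω = -1 - ω) : (herm 1 1 ω).det = 0 := by
  rw [det_herm, hs]; push_cast; linear_combination hω

/-- … and `J` maps such a curve to another unit curve: `J^*[[1, ω],[ω̄, 1]] = [[1, 1+ω],[…, 1]]` (`−ω̄ = 1 + ω = −ω²`). -/
theorem pull_Jm_omega_curve (ω : R) (hs : star ω = -1 - ω) : pull Jm (herm 1 1 ω) = herm 1 1 (1 + ω) := by
  rw [pull_Jm, hs]; congr 1; ring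

/-! ### Polarized versus unpolarized automorphisms; the Pell unit of `E_ω` (memo §2 (iv), §4 (P))

An automorphism commuting with `J` is `x·1 + y·J`; it preserves the principal polarization `I` iff `|x|² + |y|² = 1`, `xȳ = yx̄`,
which forces `xy = 0` — so the POLARIZED automorphisms are `μ(End E)·{1, J}` and act on the charged letters by `±1` (the kernel
statement `pull_unit_scalar` + `pull_Jm_of_anti`). On `E_ω`, however, `ℤ[ω][J] = ℤ[ζ₁₂]` has unit rank one: `g = 1 + ω·J` has
`det g = 1 + ω² = −ω`, is an (unpolarized) automorphism of `(E_ω², J)`, rotates the Weil coordinate by a quarter-turn and acts on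
the `μ`-blind plane `(I, τ)` (form `a² − 3d²`) by the Pell unit `2 + √3`: it moves `I` to the principal polarization `2I − τ`. -/

/-- The unpolarized automorphism `g = 1 + ω·J = [[1, ω],[−ω, 1]]` of `(E_ω², J)`. -/
def pellm (ω : R) : Matrix (Fin 2) (Fin 2) R := !![1, ω; -ω, 1]

omit [StarRing R] in
theorem pellm_comm (ω : R) : pellm ω * Jm = Jm * pellm ω := by
  ext x y; fin_cases x <;> fin_cases y <;> simp [pellm, Jm, Matrix.mul_apply, Fin.sum_univ_two]

omit [StarRing R] in
/-- `det (1 + ωJ) = 1 + ω² = −ω`, a unit: `g` is an automorphism (for a primitive cube root of unity `ω`). -/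
theorem det_pellm (ω : R) (hω : ω * ω + ω + 1 = 0) : (pellm ω).det = -ω := by
  simp [pellm, Matrix.det_fin_two]; linear_combination hω

section Pell

variable (ω : R) (hω : ω * ω + ω + 1 = 0) (hs : star ω = -1 - ω)
include hω hs

/-- `g^*I = 2I − τ`, `τ = σ_θ = herm 0 0 θ` with `θ = ω − ω̄ = √−3`: the Pell automorphism MOVES the polarization `I`. -/
theorem pull_pellm_I : pull (pellm ω) (herm 1 1 0) = herm 2 2 (star ω - ω) := by
  ext x y; fin_cases x <;> fin_cases y <;>
    simp [pull, pellm, herm, Matrix.mul_apply, Fin.sum_univ_two, hs] <;>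
    first
    | ring1
    | linear_combination hω
    | linear_combination (-1 : R) * hω

/-- … to another PRINCIPAL polarization: `V(2I − τ) = 4 − 3 = 1`. -/
theorem det_pull_pellm_I : (herm 2 2 (star ω - ω) : Matrix (Fin 2) (Fin 2) R).det = 1 := by
  rw [det_herm]
  simp [hs]
  first
  | ring1
  | linear_combination (4 : R) * hω

/-- `g^*τ = −3I + 2τ`: on the `μ`-blind plane `(I, τ)` the matrix of `g^*` is `[[2, −3],[−1, 2]]` (det 1, trace 4: the Pell unit `2 + √3`). -/
theorem pull_pellm_tau : pull (pellm ω) (herm 0 0 (ω - star ω)) = herm (-3) (-3) (2 * (ω - star ω)) := by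
  ext x y; fin_cases x <;> fin_cases y <;>
    simp [pull, pellm, herm, Matrix.mul_apply, Fin.sum_univ_two, hs] <;>
    first
    | ring1
    | linear_combination (4 : R) * hω
    | linear_combination (-4 : R) * hω
    | linear_combination (1 + 2 * ω) * hω
    | linear_combination (-(1 + 2 * ω)) * hω

/-- `g^*L_g = −L_b` … -/
theorem pull_pellm_Lg : pull (pellm ω) (herm 1 (-1) 0) = -(herm 0 0 (1 : R)) := by
  ext x y; fin_cases x <;> fin_cases y <;>
    simp [pull, pellm, herm, Matrix.mul_apply, Fin.sum_univ_two, hs] <;>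
    first
    | ring1
    | linear_combination hω
    | linear_combination (-1 : R) * hω

/-- … and `g^*L_b = L_g`: on the charged letters `g` is the quarter-turn `β = (g+ib)/2 ↦ −iβ`, although `g` fixes no polarization. -/
theorem pull_pellm_Lb : pull (pellm ω) (herm 0 0 (1 : R)) = herm 1 (-1) 0 := by
  ext x y; fin_cases x <;> fin_cases y <;>
    simp [pull, pellm, herm, Matrix.mul_apply, Fin.sum_univ_two, hs] <;>
    first
    | ring1
    | linear_combination hω

end Pell

end Summit.HodgeConjecture.HodgeConjecture.Cruxes.BlochSeedDiscOne.JFrame
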